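import Literature.RingTheory.HilbertSamuel.NormalFlatnessHilbertFunction
import Mathlib.LinearAlgebra.Quotient.Pi
import HarnessLib

/-!
# `ℓ_B(B/𝔫ⁿ⁺¹) ≤ Σ_{i ≤ n} H_A(i) · ℓ_B(B/(𝔪B + (y)^{n+1-i}))` for a local homomorphism with
# `𝔫 = 𝔪B + (y₁, …, y_d)` (the easy half of CJS 2020, Lemma 2.27 (2) / (2.6))

Topic: `Literature/RingTheory/HilbertSamuel`. Cossart–Jannsen–Saito, LNM 2270, Lemma 2.27 (2) and
Lemma 2.37 (1): for a flat local homomorphism `(A, 𝔪) → (B, 𝔫)` of Noetherian local rings whose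
fibre `B̄ = B/𝔪B` is regular of dimension `d`, `H^{(0)}_B = H^{(d)}_A` ((2.6), (2.11); Bennett,
Singh). Writing `𝔫 = 𝔪B + (y₁, …, y_d)` with `ȳ` a regular system of parameters of `B̄`, the
filtration `F_i = 𝔪ⁱB + 𝔫ⁿ⁺¹` (`0 ≤ i ≤ n + 1`) of `B/𝔫ⁿ⁺¹` has subquotients
`F_i/F_{i+1}` which are quotients of `(B/(𝔪B + (y)^{n+1-i}))^{μ(𝔪ⁱ)}` through
`(b_g)_g ↦ Σ_g b_g g` (`g` running through `μ(𝔪ⁱ) = H_A(i)` generators of `𝔪ⁱ`). This file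
PROVES the resulting inequality, valid for EVERY local homomorphism of Noetherian local rings with
`𝔫 = 𝔪B + (y₁, …, y_d)` (no flatness, no regularity):

* `length_quotient_pow_le_sum` — **`ℓ_B(B/𝔫ⁿ⁺¹) ≤ Σ_{i ≤ n} H_A(i) · ℓ_B(B/(𝔪B + (y)^{n+1-i}))`**.

With `B̄` regular of dimension `d` and `(ȳ) = 𝔫̄` the right-hand side is
`Σ_i H_A(i) · binom(n-i+d, d) = H_A^{(d+1)}(n)`, so this is `H^{(1)}_B ≤ H^{(d+1)}_A`; equality
(for `B` flat over `A`) is the subject of `FlatRegularFibreHilbert.lean`. No definitions and no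
named facts are introduced.

## Sources

* V. Cossart, U. Jannsen, S. Saito, *Desingularization: Invariants and Strategy*, LNM 2270
  (2020), Lemma 2.27 (2) ((2.5), (2.6)), Lemma 2.37 (1) ((2.11)). [CossartJannsenSaito2020]
* B. Singh, *Effect of a permissible blowing-up on the local Hilbert functions*, Invent. Math.
  26 (1974), 201–212 (the source cited by CJS for (2.6)). Background.
-/

noncomputable section

open IsLocalRing Finset

namespace Literature.RingTheory.HilbertSamuel

universe u

variable {A : Type u} {B : Type u} [CommRing A] [CommRing B] [IsLocalRing A] [IsLocalRing B]
  [IsNoetherianRing A] [Algebra A B]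

omit [IsLocalRing B] [IsNoetherianRing A] in
/-- `(𝔪ⁱ)B = (𝔪B)ⁱ`. [folklore] -/
theorem map_pow_maximalIdeal (i : ℕ) :
    (maximalIdeal A ^ i).map (algebraMap A B) = (maximalIdeal A).map (algebraMap A B) ^ i :=
  Ideal.map_pow _ _ _

/-- **The subquotients of the filtration `F_i = 𝔪ⁱB + 𝔫ⁿ⁺¹`.** For a local homomorphism with
`𝔪B + Y = 𝔫`, `Y = (y₁, …, y_d)`, and `i ≤ n`:
`ℓ_B(F_i/F_{i+1}) ≤ H_A(i) · ℓ_B(B/(𝔪B + Y^{n+1-i}))` — `F_i/F_{i+1}` is the image of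
`(b_g) ↦ Σ_g b_g g` on `B^{G}`, `G` a set of `μ(𝔪ⁱ) = H_A(i)` generators of `𝔪ⁱ`, which kills
`(𝔪B + Y^{n+1-i})^G`. [cite: CossartJannsenSaito2020, Lemma 2.27 (2)] -/
theorem length_map_mkQ_filtration_le {d : ℕ} (y : Fin d → B)
    (hn : (maximalIdeal A).map (algebraMap A B) ⊔ Ideal.span (Set.range y) = maximalIdeal B)
    (n i : ℕ) (hi : i ≤ n) :
    Module.length B (Submodule.map
        ((maximalIdeal A).map (algebraMap A B) ^ (i + 1) ⊔ maximalIdeal B ^ (n + 1)).mkQ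
        ((maximalIdeal A).map (algebraMap A B) ^ i ⊔ maximalIdeal B ^ (n + 1))) ≤
      hilbertFun A i * Module.length B (B ⧸ ((maximalIdeal A).map (algebraMap A B) ⊔
        Ideal.span (Set.range y) ^ (n + 1 - i))) := by
  classical
  set M : Ideal B := (maximalIdeal A).map (algebraMap A B) with hM
  set Y : Ideal B := Ideal.span (Set.range y) with hY
  set F₁ : Ideal B := M ^ (i + 1) ⊔ maximalIdeal B ^ (n + 1) with hF₁
  set J : Ideal B := M ⊔ Y ^ (n + 1 - i) with hJ
  have hMle : M ≤ maximalIdeal B := by rw [← hn]; exact le_sup_left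
  have hYle : Y ≤ maximalIdeal B := by rw [← hn]; exact le_sup_right
  -- generators of `𝔪ⁱ`
  obtain ⟨G, hGcard, hGspan⟩ := Submodule.FG.exists_span_finset_card_eq_spanFinrank
    (IsNoetherian.noetherian (maximalIdeal A ^ i))
  have hGcard' : G.card = hilbertFun A i := by rw [hGcard, hilbertFun_eq_spanFinrank_pow]
  -- the map `(b_g) ↦ Σ b_g g` into `B / F_{i+1}`
  let v : G → B := fun g => algebraMap A B g
  let Φ : (G → B) →ₗ[B] B ⧸ F₁ := F₁.mkQ ∘ₗ Fintype.linearCombination B v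
  -- its range is `F_i / F_{i+1}`
  have hMi : M ^ i = Ideal.span (Set.range v) := by
    rw [hM, ← map_pow_maximalIdeal, show maximalIdeal A ^ i = Ideal.span (G : Set A) from hGspan.symm,
      Ideal.map_span]
    congr 1
    ext b
    simp only [Set.mem_image, Finset.mem_coe, Set.mem_range, v, Subtype.exists, exists_prop]
  have hrange : LinearMap.range Φ = Submodule.map F₁.mkQ (M ^ i ⊔ maximalIdeal B ^ (n + 1)) := by
    rw [LinearMap.range_comp, Fintype.range_linearCombination, Submodule.map_sup]
    have h0 : Submodule.map F₁.mkQ (maximalIdeal B ^ (n + 1)) = ⊥ :=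
      map_mkQ_eq_bot_of_le (by rw [hF₁]; exact le_sup_right)
    rw [h0, sup_bot_eq, hMi]
  -- `Φ` kills `J^G`
  have hker : Submodule.pi Set.univ (fun _ : G => (J.restrictScalars B : Submodule B B)) ≤
      LinearMap.ker Φ := by
    intro b hb
    rw [LinearMap.mem_ker]
    change F₁.mkQ (Fintype.linearCombination B v b) = 0
    rw [Submodule.mkQ_apply, Submodule.Quotient.mk_eq_zero, Fintype.linearCombination_apply]
    refine Ideal.sum_mem _ fun g _ => ?_
    have hbg : b g ∈ J := hb g (Set.mem_univ g)
    have hvg : v g ∈ M ^ i := by rw [hMi]; exact Ideal.subset_span ⟨g, rfl⟩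
    rw [hJ] at hbg
    obtain ⟨m, hm, w, hw, hmw⟩ := Submodule.mem_sup.mp hbg
    rw [← hmw, add_smul, smul_eq_mul, smul_eq_mul]
    refine Ideal.add_mem _ ?_ ?_
    · -- `m · g ∈ M^{i+1}`
      refine (show M ^ (i + 1) ≤ F₁ from le_sup_left) ?_
      rw [pow_succ']
      exact Ideal.mul_mem_mul hm hvg
    · -- `w · g ∈ Y^{n+1-i} M^i ⊆ 𝔫ⁿ⁺¹`
      refine (show maximalIdeal B ^ (n + 1) ≤ F₁ from le_sup_right) ?_
      have h1 : w * v g ∈ maximalIdeal B ^ (n + 1 - i) * maximalIdeal B ^ i :=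
        Ideal.mul_mem_mul (Ideal.pow_right_mono hYle _ hw) (Ideal.pow_right_mono hMle _ hvg)
      rw [← pow_add, show n + 1 - i + i = n + 1 by omega] at h1
      exact h1
  -- hence `F_i/F_{i+1}` is a quotient of `(B/J)^G`
  have hlen1 : Module.length B (LinearMap.range Φ) ≤
      Module.length B ((G → B) ⧸ Submodule.pi Set.univ (fun _ : G => (J.restrictScalars B : Submodule B B))) := by
    -- `range Φ ≅ (G → B)/ker Φ`, a quotient of `(G → B)/J^G`
    have e := Φ.quotKerEquivRange
    rw [← e.length_eq]
    exact Module.length_le_of_surjective (Submodule.factor hker) (Submodule.factor_surjective hker)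
  have hlen2 : Module.length B ((G → B) ⧸ Submodule.pi Set.univ
      (fun _ : G => (J.restrictScalars B : Submodule B B))) = G.card * Module.length B (B ⧸ J) := by
    rw [(Submodule.quotientPi (fun _ : G => (J.restrictScalars B : Submodule B B))).length_eq,
      Module.length_pi]
    congr 1
    rw [ENat.card_eq_coe_fintype_card, Fintype.card_coe]
  calc Module.length B (Submodule.map F₁.mkQ (M ^ i ⊔ maximalIdeal B ^ (n + 1)))
      = Module.length B (LinearMap.range Φ) := by rw [hrange]
    _ ≤ G.card * Module.length B (B ⧸ J) := hlen1.trans (le_of_eq hlen2)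
    _ = hilbertFun A i * Module.length B (B ⧸ J) := by rw [hGcard']

/-- **`ℓ_B(B/𝔫ⁿ⁺¹) ≤ Σ_{i ≤ n} H_A(i) · ℓ_B(B/(𝔪B + Y^{n+1-i}))`** for every local homomorphism
of Noetherian local rings `(A, 𝔪) → (B, 𝔫)` with `𝔫 = 𝔪B + Y`, `Y = (y₁, …, y_d)`: the
filtration `F_i = 𝔪ⁱB + 𝔫ⁿ⁺¹`, `F_0 = B`, `F_{n+1} = 𝔫ⁿ⁺¹`, and
`length_map_mkQ_filtration_le`. (For `B̄ = B/𝔪B` regular of dimension `d` with `𝔫̄ = (ȳ)` the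
right-hand side is `H_A^{(d+1)}(n)`; equality holds for `B` flat over `A`, CJS (2.6).)
[cite: CossartJannsenSaito2020, Lemma 2.27 (2)] -/
theorem length_quotient_pow_le_sum {d : ℕ} (y : Fin d → B)
    (hn : (maximalIdeal A).map (algebraMap A B) ⊔ Ideal.span (Set.range y) = maximalIdeal B)
    (n : ℕ) :
    Module.length B (B ⧸ maximalIdeal B ^ (n + 1)) ≤
      ∑ i ∈ range (n + 1), (hilbertFun A i : ℕ∞) * Module.length B (B ⧸
        ((maximalIdeal A).map (algebraMap A B) ⊔ Ideal.span (Set.range y) ^ (n + 1 - i))) := by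
  set M : Ideal B := (maximalIdeal A).map (algebraMap A B) with hM
  have hMle : M ≤ maximalIdeal B := by rw [← hn]; exact le_sup_left
  -- the filtration
  let F : ℕ → Ideal B := fun i => M ^ i ⊔ maximalIdeal B ^ (n + 1)
  have hFanti : ∀ i, F (i + 1) ≤ F i := fun i =>
    sup_le_sup_right (Ideal.pow_le_pow_right (Nat.le_succ i)) _
  have hF0 : F 0 = ⊤ := by simp [F]
  have hFend : F (n + 1) = maximalIdeal B ^ (n + 1) :=
    sup_eq_right.mpr (Ideal.pow_right_mono hMle _)
  -- telescoping
  have htel : ∀ k, Module.length B (B ⧸ F k) =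
      ∑ i ∈ range k, Module.length B (Submodule.map (F (i + 1)).mkQ (F i)) := by
    intro k
    induction k with
    | zero =>
      rw [sum_range_zero, hF0]
      haveI : Subsingleton (B ⧸ (⊤ : Ideal B)) := Ideal.Quotient.subsingleton_iff.mpr rfl
      exact Module.length_eq_zero
    | succ k ih =>
      rw [sum_range_succ, length_quotient_eq_length_map_add (hFanti k), ih, add_comm]
  calc Module.length B (B ⧸ maximalIdeal B ^ (n + 1)) = Module.length B (B ⧸ F (n + 1)) := by
        rw [hFend]
    _ = ∑ i ∈ range (n + 1), Module.length B (Submodule.map (F (i + 1)).mkQ (F i)) := htel (n + 1)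
    _ ≤ ∑ i ∈ range (n + 1), (hilbertFun A i : ℕ∞) * Module.length B (B ⧸
          (M ⊔ Ideal.span (Set.range y) ^ (n + 1 - i))) :=
        sum_le_sum fun i hi => length_map_mkQ_filtration_le y hn n i
          (Nat.lt_succ_iff.mp (mem_range.mp hi))

end Literature.RingTheory.HilbertSamuel
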